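/-
Copyright (c) 2026 the pub-hodgecm-mathlib formalisation cell (harness21).  Prover seat hodgecm-mathlib-F0P2-p01 (g11), programme P2,
row B‴ (sequel) «Θ-OCC-GEN AT THE FRAME FROM THETA PAIRS» for the desk's OCC♭-GEN line (`F0/P2/F0_P2OccFlatGeneral.prewrite.ed1.F0P2-plan-g12.lean`,
stub Θ-OCC-GEN `StubThetaOccursInGen`), 2026-09-01.  KERNEL module: THEOREMS ONLY (no definition, no named fact, no `sorry`, no instance, no notation).
-/
import Summits.HodgeConjecture.HodgeConjecture.Theorems.F0P2sThetaFunIntertwiner   -- B‴ part 1: the theta intertwiner in function currency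
import HarnessLib

/-!
# FLOOR-0 P2 · B‴ (sequel) «Θ-OCC-GEN AT THE FRAME FROM THETA PAIRS»: `∃ θ ≠ 0`, `A`-valued, `ρ(a,χ)`-equivariant — from (T∀) + (N)

Cell hodgecm-mathlib (D-0151), FLOOR 0; crux item H413 = stmt-HodgeConjecture-24833 (route `HCCMUnconditional`, no route verbs); programme P2, the
OCC♭-GEN pay-down line of OCC♭∀ (books #155′; desk F0P2-plan (g12) ED. 1 prewrite `F0/P2/F0_P2OccFlatGeneral.prewrite.ed1.F0P2-plan-g12.lean`, ONE letter
Θ-OCC-GEN `StubThetaOccursInGen` in FUNCTION currency).  Sequel of ★ `Theorems/F0P2sThetaFunIntertwiner.lean` (§1 pointwise identities, §2 the theta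
intertwiner `θ_{φ} : omegaAtLine … a χ →ₗ[ℂ] (U(H)(𝔸_{L⁺}) → ℂ²)` at the canonical `ιV`), split off by the 400-line rule.  THEOREMS ONLY;
`--supports stmt-HodgeConjecture-24833`.  HONEST LABEL: HC_CM is proved only modulo the printed citations until rung 0 closes; this file closes NO
print letter and asserts nothing of [Liu2021].

## What is proved (any rank `N`; same frame ∕ theta data binders as part 1)
* §2′ **`exists_thetaFunIntertwiner_rhoAtLine_of_coe`** — part 1's intertwiner for ANY finite transport `ιV` pinned by `↑(ιV k) = g_f⁻¹ · k · g_f` (the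
  `hιV` binder of Θ-OCC-GEN ∕ OCC♭∀; ★ `eq_finPart_cmAdelicFrameTransport_finAdelicToAdelic_of_coe`).
* §3 **`exists_ne_zero_forall_mem_thetaFunIntertwiner{,_of_coe}`** — for any submodule `A` of `ℂ²`-valued functions on `U(H)(𝔸_{L⁺})` (the letter's
  `A = cohForms … (cmArchSection …) (cmCompactFactor …)`): if EVERY theta pair `fun x j ↦ Θ̃_{R_e E(φ_j ⊗ Φ_f)}(charCM χ̃_χ)(ιA x)` lies in `A` — (T∀) —
  and ONE of them is non-zero — (N) — then `∃ θ : omegaAtLine … a χ →ₗ[ℂ] (U(H)(𝔸_{L⁺}) → ℂ²), θ ≠ 0 ∧ (∀ w, θ w ∈ A) ∧ ∀ k w, θ (rhoAtLine … ιV a χ k w) =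
  fun x ↦ θ w (x * finAdelicToAdelic k)` — the `∃ θ`-clause of `StubThetaOccursInGen` token for token at `N = 3`, `A = cohForms …`.
⇒ Θ-OCC-GEN ⟸ «for every admissible `(a, χ)` there are `hρ, μW, φ₀, φ₁` with (T∀) all theta pairs cohomological-cotangent and (N) one theta pair ≠ 0»
([GelbartRogawski1991, Prop. 3.1.1] non-vanishing; [KonnoKonno2007] ∕ [Liu2021, Lem. D.2] the archimedean type).

## References
* [Liu2021] Y. Liu, *Fourier–Jacobi cycles and arithmetic relative trace formula*, Camb. J. Math. 9 (2021) = arXiv:2102.11518, proof of Prop. 4.13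
  (Case 1 l. 2131–2137; «Conversely» l. 2145–2149); Def. 4.11 (l. 2090–2096); App. D §D.1 Step 3 (l. 5219–5221).
* [Rallis1984] S. Rallis, *On the Howe duality conjecture*, Compositio Math. 51 (1984), proof of Thm. 1.2.2 p. 356.
* [GelbartRogawski1991] S. Gelbart, J. Rogawski, Invent. Math. 105 (1991), §3.1 Prop. 3.1.1, §3.2 p. 457.
* [BorelJacquet1979] A. Borel, H. Jacquet, PSPM 33.1 (1979), §4.1, §4.6.
-/

set_option autoImplicit false

-- the mandated namespace has the single-problem summit's repeated segment (`HodgeConjecture.HodgeConjecture`)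
set_option linter.dupNamespace false

noncomputable section

open NumberField MeasureTheory IsDedekindDomain
open scoped Matrix Kronecker ComplexOrder ENNReal SchwartzMap TensorProduct Classical

namespace Summit.HodgeConjecture.HodgeConjecture.Cruxes.H413.F0P2sThetaOccursInOfPairs

open Literature.NumberTheory.Automorphic Literature.NumberTheory.Automorphic.UnitaryGroup
open Literature.NumberTheory.Automorphic.UnitaryGroup.CotangentForms
open Literature.NumberTheory.Automorphic.IdeleClassGroup
open Literature.NumberTheory.Automorphic.Liu2021
open Literature.NumberTheory.Automorphic.Liu2021.Def411WeilCarriers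
open Literature.NumberTheory.Automorphic.Liu2021.Def411WeilCarriersDoubling
open Literature.NumberTheory.GelbartRogawski1991 Literature.NumberTheory.GelbartRogawski1991.UnitaryDualPair
open Literature.NumberTheory.GelbartRogawski1991.UnitaryDualPair.WeilCoinv
open Literature.NumberTheory.Weil1964
open Literature.RepresentationTheory Literature.RepresentationTheory.Liu2021
open Literature.RepresentationTheory.CompactGroups
open Summit.HodgeConjecture.HodgeConjecture.Cruxes.H413.F0P2sThetaFunIntertwiner

variable (L : Type) [Field L] [NumberField L] [IsCMField L] (N : ℕ) (H : Matrix (Fin N) (Fin N) L)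
  {n' : ℕ} (e₁ : Fin N × Fin 1 ≃ Fin n') (dV : Fin N → L) (hdV : ∀ i, IsCMField.complexConj L (dV i) = dV i)
  (hdV0 : ∀ i, dV i ≠ 0) (g : GL (Fin N) L)
  (hg : ((g : Matrix (Fin N) (Fin N) L).map (cmConjRingHom L))ᵀ * H * (g : Matrix (Fin N) (Fin N) L) = Matrix.diagonal dV)
  (μ : Literature.NumberTheory.Automorphic.IdeleClassGroup L →ₜ* Circle) (hμ : IsConjugateSymplectic L μ) (a : (↥(maximalRealSubfield L))ˣ)
  (hρ : HasThetaMajorants fun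
      (p : ↥(UnitaryGroup.adelic (↥(maximalRealSubfield L)) L (IsCMField.complexConj L) N (Matrix.diagonal dV)) × ↥(UnitaryGroup.adelic (↥(maximalRealSubfield L)) L (IsCMField.complexConj L) 1 (JW (↥(maximalRealSubfield L)) L a))) (Φ : piSchwartzBruhat (↥(maximalRealSubfield L)) (Fin n')) =>
        pairRep (↥(maximalRealSubfield L)) L (IsCMField.complexConj L) N 1 e₁ (Matrix.diagonal dV) (JW (↥(maximalRealSubfield L)) L a)
          (chiSplittingLine L e₁ dV hdV hdV0 (toHeckeCharacter L μ) (isUnitary_toHeckeCharacter L μ)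
            ((isOscillatorChar_toHeckeCharacter_iff μ).mpr hμ) (TW (↥(maximalRealSubfield L)) a)
            (isUnit_det_TW (↥(maximalRealSubfield L)) a) (JW (↥(maximalRealSubfield L)) L a) (JW_eq (↥(maximalRealSubfield L)) L a))
          p Φ)
  [CompactSpace (↥(UnitaryGroup.adelic (↥(maximalRealSubfield L)) L (IsCMField.complexConj L) N (Matrix.diagonal dV)) ⧸ (UnitaryGroup.toAdelic (↥(maximalRealSubfield L)) L (IsCMField.complexConj L) N (Matrix.diagonal dV)).range)] [MeasurableSpace (↥(UnitaryGroup.adelic (↥(maximalRealSubfield L)) L (IsCMField.complexConj L) 1 (JW (↥(maximalRealSubfield L)) L a)) ⧸ (UnitaryGroup.toAdelic (↥(maximalRealSubfield L)) L (IsCMField.complexConj L) 1 (JW (↥(maximalRealSubfield L)) L a)).range)] [BorelSpace (↥(UnitaryGroup.adelic (↥(maximalRealSubfield L)) L (IsCMField.complexConj L) 1 (JW (↥(maximalRealSubfield L)) L a)) ⧸ (UnitaryGroup.toAdelic (↥(maximalRealSubfield L)) L (IsCMField.complexConj L) 1 (JW (↥(maximalRealSubfield L)) L a)).range)] (μW :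 Measure (↥(UnitaryGroup.adelic (↥(maximalRealSubfield L)) L (IsCMField.complexConj L) 1 (JW (↥(maximalRealSubfield L)) L a)) ⧸ (UnitaryGroup.toAdelic (↥(maximalRealSubfield L)) L (IsCMField.complexConj L) 1 (JW (↥(maximalRealSubfield L)) L a)).range)) [IsFiniteMeasure μW]

variable [SMulInvariantMeasure ↥(UnitaryGroup.adelic (↥(maximalRealSubfield L)) L (IsCMField.complexConj L) 1 (JW (↥(maximalRealSubfield L)) L a)) (↥(UnitaryGroup.adelic (↥(maximalRealSubfield L)) L (IsCMField.complexConj L) 1 (JW (↥(maximalRealSubfield L)) L a)) ⧸ (UnitaryGroup.toAdelic (↥(maximalRealSubfield L)) L (IsCMField.complexConj L) 1 (JW (↥(maximalRealSubfield L)) L a)).range) μW]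

/-! ## §2′ The theta intertwiner at a pinned finite transport -/

include hg in
set_option maxHeartbeats 1600000 in
/-- **B‴ at a PINNED finite transport** `ιV` with `↑(ιV k) = g_f⁻¹ · k · g_f` (the `hιV` binder of Θ-OCC-GEN ∕ OCC♭∀; it IS the canonical one, ★
`eq_finPart_cmAdelicFrameTransport_finAdelicToAdelic_of_coe`): the theta intertwiner of `exists_thetaFunIntertwiner_rhoAtLine` for `rhoAtLine … ιV a χ`.
[cite: Liu2021, proof of Prop. 4.13 Case 1 (l. 2136–2137, p. 48); App. D §D.1 Step 3 (l. 5219–5221)] [cite: Rallis1984, Thm. 1.2.2 proof p. 356]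
[cite: BorelJacquet1979, §4.1] -/
theorem exists_thetaFunIntertwiner_rhoAtLine_of_coe
    (φ : Fin 2 → 𝓢(((Fin N × Fin 1) → NumberField.mixedEmbedding.mixedSpace ↥(maximalRealSubfield L)), ℂ))
    (χ : Chi (↥(maximalRealSubfield L)) L (IsCMField.complexConj L))
    (ιV : finAdelic (↥(maximalRealSubfield L)) L (IsCMField.complexConj L) N H →*
      finAdelic (↥(maximalRealSubfield L)) L (IsCMField.complexConj L) N (Matrix.diagonal dV))
    (hιV : ∀ k, ((ιV k : finAdelic (↥(maximalRealSubfield L)) L (IsCMField.complexConj L) N (Matrix.diagonal dV)) :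
          GL (Fin N) (FiniteAdeleRing (𝓞 L) L)) =
        (toFinAdeleGL L N g)⁻¹ * (k : GL (Fin N) (FiniteAdeleRing (𝓞 L) L)) * toFinAdeleGL L N g) :
    haveI := normal_range_toAdelic_JW L a
    ∃ θ : omegaAtLine (↥(maximalRealSubfield L)) L (IsCMField.complexConj L) N e₁ (Matrix.diagonal dV)
          (complexConj_imagUnit L) (imagUnit_ne_zero L) (imagUnit_mul_self L) (realDiagonal_isSymm L dV hdV)
          (isUnit_det_realDiagonal L dV hdV hdV0) (realDiagonal_map L dV hdV).symm
          (fun b => isCompatible_chiSplittingLine L e₁ dV hdV hdV0 (toHeckeCharacter L μ)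
            (isUnitary_toHeckeCharacter L μ) ((isOscillatorChar_toHeckeCharacter_iff μ).mpr hμ)
            (TW (↥(maximalRealSubfield L)) b) (isSymm_TW (↥(maximalRealSubfield L)) b)
            (isUnit_det_TW (↥(maximalRealSubfield L)) b) (JW (↥(maximalRealSubfield L)) L b)
            (JW_eq (↥(maximalRealSubfield L)) L b)) a χ →ₗ[ℂ]
        ((adelicGroupData (↥(maximalRealSubfield L)) L (IsCMField.complexConj L) N H).Adelic → (Fin 2 → ℂ)),
      (∀ Φf : FinSB (↥(maximalRealSubfield L)) (Fin N × Fin 1),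
          θ (TwistedCoinv.mk _ _ Φf) = fun x j =>
            (lineThetaKernelDatum L N e₁ dV hdV hdV0 μ hμ a hρ).thetaLiftFun μW
              (piSBReindex (↥(maximalRealSubfield L)) e₁ (piSchwartzBruhatEquiv (↥(maximalRealSubfield L)) (Fin N × Fin 1) (φ j ⊗ₜ[ℂ] Φf)))
              (charCM (chiQuot (↥(maximalRealSubfield L)) L (IsCMField.complexConj L) (Algebra.IsQuadraticExtension.finrank_eq_two _ L)
                (IsCMField.complexConj_ne_one (K := L)) a χ))
              ((cmAdelicFrameTransport L N H dV g hg) x)) ∧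
        ∀ (k : finAdelic (↥(maximalRealSubfield L)) L (IsCMField.complexConj L) N H) (w),
          θ (rhoAtLine (↥(maximalRealSubfield L)) L (IsCMField.complexConj L) N e₁ (Matrix.diagonal dV)
              (complexConj_imagUnit L) (imagUnit_ne_zero L) (imagUnit_mul_self L) (realDiagonal_isSymm L dV hdV)
              (isUnit_det_realDiagonal L dV hdV hdV0) (realDiagonal_map L dV hdV).symm
              (fun b => isCompatible_chiSplittingLine L e₁ dV hdV hdV0 (toHeckeCharacter L μ)
                (isUnitary_toHeckeCharacter L μ) ((isOscillatorChar_toHeckeCharacter_iff μ).mpr hμ)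
                (TW (↥(maximalRealSubfield L)) b) (isSymm_TW (↥(maximalRealSubfield L)) b)
                (isUnit_det_TW (↥(maximalRealSubfield L)) b) (JW (↥(maximalRealSubfield L)) L b)
                (JW_eq (↥(maximalRealSubfield L)) L b)) ιV a χ k w) =
            fun x => θ w (x * finAdelicToAdelic (↥(maximalRealSubfield L)) L (IsCMField.complexConj L) N H k) := by
  obtain rfl := eq_finPart_cmAdelicFrameTransport_finAdelicToAdelic_of_coe L N H dV g hg ιV hιV
  exact exists_thetaFunIntertwiner_rhoAtLine L N H e₁ dV hdV hdV0 g hg μ hμ a hρ μW φ χ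

/-! ## §3 Occurrence from theta pairs: the `∃ θ`-clause of Θ-OCC-GEN at the frame from (T∀) + (N) -/

set_option maxHeartbeats 1600000 in
/-- **Θ-OCC-GEN AT THE FRAME FROM THETA PAIRS (canonical `ιV`).**  Let `A` be any submodule of `ℂ²`-valued functions on `U(H)(𝔸_{L⁺})` (for the
desk's letter: `A = cohForms … (cmArchSection …) (cmCompactFactor …)`).  If for archimedean factors `φ₀, φ₁` and `χ ∈ Chi` EVERY theta pair
`fun x j ↦ Θ̃_{R_e E(φ_j ⊗ Φ_f)}(charCM χ̃_χ)(ιA x)` (`Φ_f ∈ 𝒮(𝔸_f)`) lies in `A` — (T∀) — and ONE of them is non-zero — (N) — then the theta intertwiner `θ`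
of §2 is non-zero, `A`-valued and `ρ(a,χ)`-equivariant for right translation: the `∃ θ`-clause of `StubThetaOccursInGen`.
[cite: Liu2021, Prop. 4.13 («Conversely» l. 2145–2149); App. D §D.1 Step 3 (l. 5219–5221)] [cite: GelbartRogawski1991, Prop. 3.1.1; §3.2 p. 457]
[cite: Rallis1984, Thm. 1.2.2 proof p. 356] -/
theorem exists_ne_zero_forall_mem_thetaFunIntertwiner
    (A : Submodule ℂ ((adelicGroupData (↥(maximalRealSubfield L)) L (IsCMField.complexConj L) N H).Adelic → (Fin 2 → ℂ)))
    (φ : Fin 2 → 𝓢(((Fin N × Fin 1) → NumberField.mixedEmbedding.mixedSpace ↥(maximalRealSubfield L)), ℂ))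
    (χ : Chi (↥(maximalRealSubfield L)) L (IsCMField.complexConj L))
    (hT : haveI := normal_range_toAdelic_JW L a
      ∀ Φf : FinSB (↥(maximalRealSubfield L)) (Fin N × Fin 1),
        (fun (x : (adelicGroupData (↥(maximalRealSubfield L)) L (IsCMField.complexConj L) N H).Adelic) (j : Fin 2) =>
            (lineThetaKernelDatum L N e₁ dV hdV hdV0 μ hμ a hρ).thetaLiftFun μW
              (piSBReindex (↥(maximalRealSubfield L)) e₁ (piSchwartzBruhatEquiv (↥(maximalRealSubfield L)) (Fin N × Fin 1) (φ j ⊗ₜ[ℂ] Φf)))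
              (charCM (chiQuot (↥(maximalRealSubfield L)) L (IsCMField.complexConj L) (Algebra.IsQuadraticExtension.finrank_eq_two _ L)
                (IsCMField.complexConj_ne_one (K := L)) a χ))
              ((cmAdelicFrameTransport L N H dV g hg) x)) ∈ A)
    (hN : haveI := normal_range_toAdelic_JW L a
      ∃ Φf : FinSB (↥(maximalRealSubfield L)) (Fin N × Fin 1),
        (fun (x : (adelicGroupData (↥(maximalRealSubfield L)) L (IsCMField.complexConj L) N H).Adelic) (j : Fin 2) =>
            (lineThetaKernelDatum L N e₁ dV hdV hdV0 μ hμ a hρ).thetaLiftFun μW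
              (piSBReindex (↥(maximalRealSubfield L)) e₁ (piSchwartzBruhatEquiv (↥(maximalRealSubfield L)) (Fin N × Fin 1) (φ j ⊗ₜ[ℂ] Φf)))
              (charCM (chiQuot (↥(maximalRealSubfield L)) L (IsCMField.complexConj L) (Algebra.IsQuadraticExtension.finrank_eq_two _ L)
                (IsCMField.complexConj_ne_one (K := L)) a χ))
              ((cmAdelicFrameTransport L N H dV g hg) x)) ≠ 0) :
    ∃ θ : omegaAtLine (↥(maximalRealSubfield L)) L (IsCMField.complexConj L) N e₁ (Matrix.diagonal dV)
          (complexConj_imagUnit L) (imagUnit_ne_zero L) (imagUnit_mul_self L) (realDiagonal_isSymm L dV hdV)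
          (isUnit_det_realDiagonal L dV hdV hdV0) (realDiagonal_map L dV hdV).symm
          (fun b => isCompatible_chiSplittingLine L e₁ dV hdV hdV0 (toHeckeCharacter L μ)
            (isUnitary_toHeckeCharacter L μ) ((isOscillatorChar_toHeckeCharacter_iff μ).mpr hμ)
            (TW (↥(maximalRealSubfield L)) b) (isSymm_TW (↥(maximalRealSubfield L)) b)
            (isUnit_det_TW (↥(maximalRealSubfield L)) b) (JW (↥(maximalRealSubfield L)) L b)
            (JW_eq (↥(maximalRealSubfield L)) L b)) a χ →ₗ[ℂ]
        ((adelicGroupData (↥(maximalRealSubfield L)) L (IsCMField.complexConj L) N H).Adelic → (Fin 2 → ℂ)),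
      θ ≠ 0 ∧ (∀ w, θ w ∈ A) ∧
        ∀ (k : finAdelic (↥(maximalRealSubfield L)) L (IsCMField.complexConj L) N H) (w),
          θ (rhoAtLine (↥(maximalRealSubfield L)) L (IsCMField.complexConj L) N e₁ (Matrix.diagonal dV)
              (complexConj_imagUnit L) (imagUnit_ne_zero L) (imagUnit_mul_self L) (realDiagonal_isSymm L dV hdV)
              (isUnit_det_realDiagonal L dV hdV hdV0) (realDiagonal_map L dV hdV).symm
              (fun b => isCompatible_chiSplittingLine L e₁ dV hdV hdV0 (toHeckeCharacter L μ)
                (isUnitary_toHeckeCharacter L μ) ((isOscillatorChar_toHeckeCharacter_iff μ).mpr hμ)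
                (TW (↥(maximalRealSubfield L)) b) (isSymm_TW (↥(maximalRealSubfield L)) b)
                (isUnit_det_TW (↥(maximalRealSubfield L)) b) (JW (↥(maximalRealSubfield L)) L b)
                (JW_eq (↥(maximalRealSubfield L)) L b))
              ((finPart (↥(maximalRealSubfield L)) L (IsCMField.complexConj L) N (Matrix.diagonal dV)).comp
                ((cmAdelicFrameTransport L N H dV g hg).comp (finAdelicToAdelic (↥(maximalRealSubfield L)) L (IsCMField.complexConj L) N H)))
              a χ k w) =
            fun x => θ w (x * finAdelicToAdelic (↥(maximalRealSubfield L)) L (IsCMField.complexConj L) N H k) := by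
  haveI := normal_range_toAdelic_JW L a
  obtain ⟨θ, hθ, heqv⟩ := exists_thetaFunIntertwiner_rhoAtLine L N H e₁ dV hdV hdV0 g hg μ hμ a hρ μW φ χ
  obtain ⟨Φf₀, hΦf₀⟩ := hN
  refine ⟨θ, fun h0 => hΦf₀ ?_, fun w => ?_, heqv⟩
  · rw [← hθ Φf₀, h0, LinearMap.zero_apply]
  · obtain ⟨Φf, rfl⟩ := TwistedCoinv.mk_surjective _ _ w
    rw [hθ Φf]
    exact hT Φf

include hg in
set_option maxHeartbeats 1600000 in
/-- **Θ-OCC-GEN AT THE FRAME FROM THETA PAIRS, at the PINNED `ιV`** (`↑(ιV k) = g_f⁻¹ · k · g_f`, the letter's own binder): for `N = 3` and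
`A = cohForms … (cmArchSection L ι H T hT) (cmCompactFactor L ι H T hT)` the conclusion is the `∃ θ`-clause of `StubThetaOccursInGen`
(`F0/P2/F0_P2OccFlatGeneral.prewrite.ed1.F0P2-plan-g12.lean` :247) token for token.  So the letter follows from: for every admissible `(a, χ)` SOME theta
data `(hρ, μW, φ₀, φ₁)` has (T∀) every theta pair cohomological-cotangent and (N) one theta pair non-zero.
[cite: Liu2021, Prop. 4.13 («Conversely» l. 2145–2149); App. D §D.1 Step 3 (l. 5219–5221)] [cite: GelbartRogawski1991, Prop. 3.1.1; §3.2 p. 457]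
[cite: Rallis1984, Thm. 1.2.2 proof p. 356] [cite: BorelJacquet1979, §4.1] -/
theorem exists_ne_zero_forall_mem_thetaFunIntertwiner_of_coe
    (A : Submodule ℂ ((adelicGroupData (↥(maximalRealSubfield L)) L (IsCMField.complexConj L) N H).Adelic → (Fin 2 → ℂ)))
    (φ : Fin 2 → 𝓢(((Fin N × Fin 1) → NumberField.mixedEmbedding.mixedSpace ↥(maximalRealSubfield L)), ℂ))
    (χ : Chi (↥(maximalRealSubfield L)) L (IsCMField.complexConj L))
    (ιV : finAdelic (↥(maximalRealSubfield L)) L (IsCMField.complexConj L) N H →*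
      finAdelic (↥(maximalRealSubfield L)) L (IsCMField.complexConj L) N (Matrix.diagonal dV))
    (hιV : ∀ k, ((ιV k : finAdelic (↥(maximalRealSubfield L)) L (IsCMField.complexConj L) N (Matrix.diagonal dV)) :
          GL (Fin N) (FiniteAdeleRing (𝓞 L) L)) =
        (toFinAdeleGL L N g)⁻¹ * (k : GL (Fin N) (FiniteAdeleRing (𝓞 L) L)) * toFinAdeleGL L N g)
    (hT : haveI := normal_range_toAdelic_JW L a
      ∀ Φf : FinSB (↥(maximalRealSubfield L)) (Fin N × Fin 1),
        (fun (x : (adelicGroupData (↥(maximalRealSubfield L)) L (IsCMField.complexConj L) N H).Adelic) (j : Fin 2) =>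
            (lineThetaKernelDatum L N e₁ dV hdV hdV0 μ hμ a hρ).thetaLiftFun μW
              (piSBReindex (↥(maximalRealSubfield L)) e₁ (piSchwartzBruhatEquiv (↥(maximalRealSubfield L)) (Fin N × Fin 1) (φ j ⊗ₜ[ℂ] Φf)))
              (charCM (chiQuot (↥(maximalRealSubfield L)) L (IsCMField.complexConj L) (Algebra.IsQuadraticExtension.finrank_eq_two _ L)
                (IsCMField.complexConj_ne_one (K := L)) a χ))
              ((cmAdelicFrameTransport L N H dV g hg) x)) ∈ A)
    (hN : haveI := normal_range_toAdelic_JW L a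
      ∃ Φf : FinSB (↥(maximalRealSubfield L)) (Fin N × Fin 1),
        (fun (x : (adelicGroupData (↥(maximalRealSubfield L)) L (IsCMField.complexConj L) N H).Adelic) (j : Fin 2) =>
            (lineThetaKernelDatum L N e₁ dV hdV hdV0 μ hμ a hρ).thetaLiftFun μW
              (piSBReindex (↥(maximalRealSubfield L)) e₁ (piSchwartzBruhatEquiv (↥(maximalRealSubfield L)) (Fin N × Fin 1) (φ j ⊗ₜ[ℂ] Φf)))
              (charCM (chiQuot (↥(maximalRealSubfield L)) L (IsCMField.complexConj L) (Algebra.IsQuadraticExtension.finrank_eq_two _ L)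
                (IsCMField.complexConj_ne_one (K := L)) a χ))
              ((cmAdelicFrameTransport L N H dV g hg) x)) ≠ 0) :
    ∃ θ : omegaAtLine (↥(maximalRealSubfield L)) L (IsCMField.complexConj L) N e₁ (Matrix.diagonal dV)
          (complexConj_imagUnit L) (imagUnit_ne_zero L) (imagUnit_mul_self L) (realDiagonal_isSymm L dV hdV)
          (isUnit_det_realDiagonal L dV hdV hdV0) (realDiagonal_map L dV hdV).symm
          (fun b => isCompatible_chiSplittingLine L e₁ dV hdV hdV0 (toHeckeCharacter L μ)
            (isUnitary_toHeckeCharacter L μ) ((isOscillatorChar_toHeckeCharacter_iff μ).mpr hμ)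
            (TW (↥(maximalRealSubfield L)) b) (isSymm_TW (↥(maximalRealSubfield L)) b)
            (isUnit_det_TW (↥(maximalRealSubfield L)) b) (JW (↥(maximalRealSubfield L)) L b)
            (JW_eq (↥(maximalRealSubfield L)) L b)) a χ →ₗ[ℂ]
        ((adelicGroupData (↥(maximalRealSubfield L)) L (IsCMField.complexConj L) N H).Adelic → (Fin 2 → ℂ)),
      θ ≠ 0 ∧ (∀ w, θ w ∈ A) ∧
        ∀ (k : finAdelic (↥(maximalRealSubfield L)) L (IsCMField.complexConj L) N H) (w),
          θ (rhoAtLine (↥(maximalRealSubfield L)) L (IsCMField.complexConj L) N e₁ (Matrix.diagonal dV)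
              (complexConj_imagUnit L) (imagUnit_ne_zero L) (imagUnit_mul_self L) (realDiagonal_isSymm L dV hdV)
              (isUnit_det_realDiagonal L dV hdV hdV0) (realDiagonal_map L dV hdV).symm
              (fun b => isCompatible_chiSplittingLine L e₁ dV hdV hdV0 (toHeckeCharacter L μ)
                (isUnitary_toHeckeCharacter L μ) ((isOscillatorChar_toHeckeCharacter_iff μ).mpr hμ)
                (TW (↥(maximalRealSubfield L)) b) (isSymm_TW (↥(maximalRealSubfield L)) b)
                (isUnit_det_TW (↥(maximalRealSubfield L)) b) (JW (↥(maximalRealSubfield L)) L b)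
                (JW_eq (↥(maximalRealSubfield L)) L b)) ιV a χ k w) =
            fun x => θ w (x * finAdelicToAdelic (↥(maximalRealSubfield L)) L (IsCMField.complexConj L) N H k) := by
  obtain rfl := eq_finPart_cmAdelicFrameTransport_finAdelicToAdelic_of_coe L N H dV g hg ιV hιV
  exact exists_ne_zero_forall_mem_thetaFunIntertwiner L N H e₁ dV hdV hdV0 g hg μ hμ a hρ μW A φ χ hT hN


end Summit.HodgeConjecture.HodgeConjecture.Cruxes.H413.F0P2sThetaOccursInOfPairs

end
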